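import Mathlib
import Literature.MathematicalPhysics.QuantumLattice.WilsonDiracAP
import Summits.QuantumFields.QCD.Theorems.QuarksAsStableActionCriticalLineDiamagnetismStubMassLipschitz
import Summits.QuantumFields.QCD.Theorems.WilsonQuarkChessboardFlatCellOptimalStubBilinearBoundsAllN

/-!
# Mass dependence of the block Hessian, `N` colours, dimension-free constant
(helper for crux stmt-QuantumFields-9307 `FlatCellOptimal`, line `registered`, stub
`stub_hessianMarginAllN` (G2), sub-goal `stub_massLipschitzAllN` — the `Fin 3 ↦ Fin N` port of the
sibling crux stmt-QuantumFields-9734's `…CriticalLineDiamagnetismStubMassLipschitz`, gap G2a, wave 9)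

What.  On the `2⁴` block `(ℤ/2)⁴` (colour `Fin N`, ANY `N : ℕ`, spin `Fin 4`) let
`B_m = wilsonDirac ρ_N (fun e => u e.2) m 1`, `B_z` (mass `0`) be the free `r = 1` Wilson–Dirac
operators with ARBITRARY constant unitary direction links `u_μ ∈ U(N)`, and `Δ(E)` the hopping
perturbation (ℝ-linear in `E : Edge 4 2 → M_N(ℂ)`); all given by defining equations (no `let`).
With `Q_B(Y) = ½ Re tr (B⁻¹ Δ(Y) B⁻¹ Δ(Y)) − ½ Re tr (B⁻¹ Δ(Y ⋆ Y))`, `(Y ⋆ Y)_e = Y_e Y_e`: if `B_m`,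
`B_z` are coercive with constants `c_m, c_0 > 0`, then for EVERY link field `Y`
`|Q_{B_m}(Y) − Q_{B_z}(Y)| ≤ |m| · (16/(c_m √c_0) + 16/(c_0 √c_m) + 40/(√c_m √c_0)) · ‖Y‖²`
(`stub_massLipschitzAllN`) — verbatim the sibling's statement and constant (so the G2 assembly
`stub_hessianMarginOfStubsV2`, step (4), and `HessianMarginOfStubsAux.massCoeff_le` port unchanged),
valid for every `N` with NO `N`-dependence.

Why the proof changes.  The sibling bounds the tadpole part `|m| |Re tr (B_m⁻¹ B_z⁻¹ Δ(Y ⋆ Y))|` by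
Cauchy–Schwarz against `‖B_m⁻¹‖_F ≤ √(card/c_m)`, `card = 192 ↦ 64N`.  Here the trace is taken
against the trace-class structure of `Δ(Y ⋆ Y)`, which factors through kernels LINEAR in `Y`:
`Δ(Y ⋆ Y) = Σ_μ ( D(G⁺_μ) · H(Y^{(μ)}, 0) + D(G⁻_μ) · H(0, ((uY)ᴴ)^{(μ)}) )`     (`dl_sq_factor`)
with block-diagonal colour multipliers `D(G)` (`G⁺_μ(x) = u_μ Y(x,μ)`, `G⁻_μ(x) = Y(x − μ̂, μ)ᴴ`;
`D(G) · H(C⁺, C⁻) = H(G C⁺, G(· + μ̂) C⁻)`, `bd_mul_hop`) and the one-direction hopping forms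
(`H = Σ_μ H^{(μ)}`, `hop_dir_sum`).  Then `|Re tr (B_m⁻¹ B_z⁻¹ D K)| ≤ ‖D‖_F ‖K‖_F /(√c_m √c_0)`
uses coercivity through LEFT multiplications only (`abs_re_trace_inv_inv_mul_le`), and
`‖D(G^±_μ)‖_F² = 4 ‖Y‖²_μ` (`bd_frob`), `‖H(Y^{(μ)}, 0)‖_F², ‖H(0, ·^{(μ)})‖_F² ≤ 16 ‖Y‖²_μ`, whence
the tadpole part is `≤ 16 |m| ‖Y‖² /(√c_m √c_0)` (halved: `8 ≤ 40`).  The bubble part is the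
sibling's generic `MassLipschitz.bubble_sub_le` (re-EXPORTED with `resolvent_sub`,
`sqrt_frob_inv_mul_le`, `abs_half_sub_half_le`) with `‖Δ(Y)‖_F² ≤ 32 ‖Y‖²` (`BilinearBounds.dl_frob_le`).

Sources.  Folklore finite-dimensional linear algebra (second resolvent identity, Frobenius norm,
Cauchy–Schwarz, `|tr (A K)| ≤ ‖A‖_op ‖K‖_tr` in factored form); Montvay–Münster, *Quantum Fields on a
Lattice* §4.2 (Wilson fermions).  Pure theorem file (no `def`s); pattern: sibling `…StubMassLipschitz`.
-/

noncomputable section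

open scoped BigOperators Classical Matrix ComplexConjugate
open Finset
open Literature.MathematicalPhysics.QuantumLattice Literature.MathematicalPhysics.QuantumFieldTheory
  Literature.Probability.LatticeModels

namespace Summit.QuantumFields.QCD.Cruxes.FlatCellOptimal.MassLipschitz

export Summit.QuantumFields.QCD.Cruxes.CriticalLineDiamagnetism.ChessboardCellGain.MassLipschitz
  (resolvent_sub sqrt_frob_inv_mul_le bubble_sub_le abs_half_sub_half_le)

open Summit.QuantumFields.QCD.Cruxes.CriticalLineDiamagnetism.ChessboardCellGain.StubDetPerturbIRAux
  (det_ne_zero_of_coercive)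
open Summit.QuantumFields.QCD.Cruxes.FlatCellOptimal.BilinearBounds (abs_re_trace_mul_le)

variable {N : ℕ}

section Generic -- a trace against two coercive inverses, through left multiplications only
variable {ι : Type} [Fintype ι] [DecidableEq ι]

/-- For coercive `B₁`, `B₂`: `|Re tr (B₁⁻¹ (B₂⁻¹ (P K)))| ≤ ‖P‖_F ‖K‖_F / (√c₁ √c₂)`
(`|Re tr (A K)| ≤ ‖A‖_F ‖K‖_F` with `A = B₁⁻¹ (B₂⁻¹ P)` and `‖B⁻¹ X‖_F ≤ ‖X‖_F/√c` twice). -/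
theorem abs_re_trace_inv_inv_mul_le (B₁ B₂ P K : Matrix ι ι ℂ) {c₁ c₂ : ℝ} (hc₁ : 0 < c₁)
    (hc₂ : 0 < c₂)
    (hB₁ : ∀ v : ι → ℂ, c₁ * ∑ i, ‖v i‖ ^ 2 ≤ ∑ i, ‖(B₁.mulVec v) i‖ ^ 2)
    (hB₂ : ∀ v : ι → ℂ, c₂ * ∑ i, ‖v i‖ ^ 2 ≤ ∑ i, ‖(B₂.mulVec v) i‖ ^ 2) :
    |(B₁⁻¹ * (B₂⁻¹ * (P * K))).trace.re| ≤
      Real.sqrt (∑ i, ∑ j, ‖P i j‖ ^ 2) * Real.sqrt (∑ i, ∑ j, ‖K i j‖ ^ 2) /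
        (Real.sqrt c₁ * Real.sqrt c₂) := by
  have hA : Real.sqrt (∑ i, ∑ j, ‖(B₁⁻¹ * (B₂⁻¹ * P)) i j‖ ^ 2) ≤
      Real.sqrt (∑ i, ∑ j, ‖P i j‖ ^ 2) / Real.sqrt c₂ / Real.sqrt c₁ :=
    (sqrt_frob_inv_mul_le B₁ (B₂⁻¹ * P) hc₁ hB₁).trans
      (div_le_div_of_nonneg_right (sqrt_frob_inv_mul_le B₂ P hc₂ hB₂) (Real.sqrt_nonneg _))
  rw [show B₁⁻¹ * (B₂⁻¹ * (P * K)) = B₁⁻¹ * (B₂⁻¹ * P) * K by simp only [Matrix.mul_assoc]]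
  refine (abs_re_trace_mul_le _ _).trans
    ((mul_le_mul_of_nonneg_right hA (Real.sqrt_nonneg _)).trans (le_of_eq ?_))
  ring
end Generic

section BlockDiag -- block-diagonal colour multipliers `D(G)` on `(ℤ/2)⁴ × colour × spin`
variable {D : (TorusSite 4 2 → Matrix (Fin N) (Fin N) ℂ) →
    Matrix (TorusSite 4 2 × Fin N × Fin 4) (TorusSite 4 2 × Fin N × Fin 4) ℂ}

variable (hD : ∀ G, D G = Matrix.of fun p s : TorusSite 4 2 × Fin N × Fin 4 =>
    if s.1 = p.1 then (if s.2.2 = p.2.2 then G p.1 p.2.1 s.2.1 else 0) else 0)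
include hD

/-- Entries of `D(G) · M`: `G(site)` acts on the colour index of each `(site, spin)` row block. -/
theorem bd_mul_apply (G : TorusSite 4 2 → Matrix (Fin N) (Fin N) ℂ)
    (M : Matrix (TorusSite 4 2 × Fin N × Fin 4) (TorusSite 4 2 × Fin N × Fin 4) ℂ)
    (p q : TorusSite 4 2 × Fin N × Fin 4) :
    (D G * M) p q = ∑ b : Fin N, G p.1 p.2.1 b * M (p.1, b, p.2.2) q := by
  rw [hD, Matrix.mul_apply, Fintype.sum_prod_type]
  simp only [Matrix.of_apply]
  rw [Finset.sum_eq_single p.1 (fun x _ hx => by simp [hx]) (by simp)]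
  simp only [if_true]
  rw [Fintype.sum_prod_type]
  refine Finset.sum_congr rfl fun b _ => ?_
  rw [Finset.sum_eq_single p.2.2 (fun t _ ht => by simp [ht]) (by simp)]
  simp

/-- **Frobenius sum of a block-diagonal colour multiplier**: `‖D(G)‖_F² = 4 Σ_x ‖G(x)‖_F²`. -/
theorem bd_frob (G : TorusSite 4 2 → Matrix (Fin N) (Fin N) ℂ) :
    ∑ p, ∑ q, ‖D G p q‖ ^ 2 = 4 * ∑ x, ∑ a, ∑ b, ‖G x a b‖ ^ 2 := by
  simp only [hD, Matrix.of_apply]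
  rw [Fintype.sum_prod_type, Finset.mul_sum]
  refine Finset.sum_congr rfl fun x _ => ?_
  rw [Fintype.sum_prod_type, Finset.mul_sum]
  refine Finset.sum_congr rfl fun a _ => ?_
  have hs : ∀ s : Fin 4, ∑ q : TorusSite 4 2 × Fin N × Fin 4,
      ‖(if q.1 = x then (if q.2.2 = s then G x a q.2.1 else 0) else 0)‖ ^ 2 =
        ∑ b, ‖G x a b‖ ^ 2 := fun s => by
    rw [TangentDelta.sum_norm_sq_ite_site x (fun t : Fin N × Fin 4 => if t.2 = s then G x a t.1 else 0),
      Fintype.sum_prod_type]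
    refine Finset.sum_congr rfl fun b _ => ?_
    rw [Finset.sum_eq_single s (fun t _ ht => by simp [ht]) (by simp)]
    simp
  simp only [hs, Finset.sum_const, Finset.card_univ, Fintype.card_fin, nsmul_eq_mul]
  norm_num
end BlockDiag

section Hop -- the hopping form: direction splitting and block-diagonal factorisation
variable {H : (Fin 4 → TorusSite 4 2 → Matrix (Fin N) (Fin N) ℂ) →
    (Fin 4 → TorusSite 4 2 → Matrix (Fin N) (Fin N) ℂ) →
      Matrix (TorusSite 4 2 × Fin N × Fin 4) (TorusSite 4 2 × Fin N × Fin 4) ℂ}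

variable (hH : ∀ Cp Cm, H Cp Cm = Matrix.of fun p q : TorusSite 4 2 × Fin N × Fin 4 =>
    -(1 / 2 : ℂ) * ∑ μ : Fin 4,
      ((if q.1 = Literature.MathematicalPhysics.QuantumFieldTheory.Site.shift p.1 μ then
          ((1 : Matrix (Fin 4) (Fin 4) ℂ) - euclideanGamma μ) p.2.2 q.2.2 * Cp μ p.1 p.2.1 q.2.1
        else 0) +
        (if p.1 = Literature.MathematicalPhysics.QuantumFieldTheory.Site.shift q.1 μ then
          ((1 : Matrix (Fin 4) (Fin 4) ℂ) + euclideanGamma μ) p.2.2 q.2.2 * Cm μ q.1 p.2.1 q.2.1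
        else 0)))
include hH

/-- **Direction splitting**: the hopping form is the sum over `μ` of the hopping forms of the blocks
restricted to the single direction `μ`. -/
theorem hop_dir_sum (Cp Cm : Fin 4 → TorusSite 4 2 → Matrix (Fin N) (Fin N) ℂ) :
    H Cp Cm = ∑ μ : Fin 4, H (fun ν x => if ν = μ then Cp ν x else 0)
      (fun ν y => if ν = μ then Cm ν y else 0) := by
  ext p q
  simp only [hH, Matrix.sum_apply, Matrix.of_apply]
  rw [Finset.mul_sum]
  refine Finset.sum_congr rfl fun μ _ => ?_
  congr 1
  rw [Finset.sum_eq_single_of_mem μ (Finset.mem_univ μ) (fun ν _ hν => by simp [hν])]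
  simp

/-- **Block-diagonal factorisation**: `D(G)` on the LEFT of the hopping form multiplies the forward
block at `x` by `G(x)` and the backward block at `y` by `G(y + μ̂)` (the row site). -/
theorem bd_mul_hop
    {D : (TorusSite 4 2 → Matrix (Fin N) (Fin N) ℂ) →
      Matrix (TorusSite 4 2 × Fin N × Fin 4) (TorusSite 4 2 × Fin N × Fin 4) ℂ}
    (hD : ∀ G, D G = Matrix.of fun p s : TorusSite 4 2 × Fin N × Fin 4 =>
      if s.1 = p.1 then (if s.2.2 = p.2.2 then G p.1 p.2.1 s.2.1 else 0) else 0)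
    (G : TorusSite 4 2 → Matrix (Fin N) (Fin N) ℂ)
    (Cp Cm : Fin 4 → TorusSite 4 2 → Matrix (Fin N) (Fin N) ℂ) :
    D G * H Cp Cm = H (fun ν x => G x * Cp ν x)
      (fun ν y => G (Literature.MathematicalPhysics.QuantumFieldTheory.Site.shift y ν) * Cm ν y) := by
  ext p q
  rw [bd_mul_apply hD]
  simp only [hH, Matrix.of_apply, Matrix.mul_apply]
  simp only [mul_add, Finset.mul_sum, Finset.sum_add_distrib, mul_ite, mul_zero]
  congr 1
  · rw [Finset.sum_comm]
    refine Finset.sum_congr rfl fun μ _ => ?_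
    by_cases h : q.1 = Literature.MathematicalPhysics.QuantumFieldTheory.Site.shift p.1 μ
    · simp only [h, if_true]
      exact Finset.sum_congr rfl fun b _ => by ring
    · simp only [h, if_false, Finset.sum_const_zero]
  · rw [Finset.sum_comm]
    refine Finset.sum_congr rfl fun μ _ => ?_
    by_cases h : p.1 = Literature.MathematicalPhysics.QuantumFieldTheory.Site.shift q.1 μ
    · simp only [h, if_true]
      exact Finset.sum_congr rfl fun b _ => by ring
    · simp only [h, if_false, Finset.sum_const_zero]

omit hH in
/-- Frobenius sum of a direction-restricted block field. -/
theorem frob_dirOnly (μ : Fin 4) (C : Fin 4 → TorusSite 4 2 → Matrix (Fin N) (Fin N) ℂ) :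
    ∑ ν : Fin 4, ∑ x : TorusSite 4 2, ∑ a, ∑ b, ‖(if ν = μ then C ν x else 0) a b‖ ^ 2 =
      ∑ x : TorusSite 4 2, ∑ a, ∑ b, ‖C μ x a b‖ ^ 2 := by
  rw [Finset.sum_eq_single_of_mem μ (Finset.mem_univ μ) (fun ν _ hν => by simp [hν])]
  simp

/-- Forward hopping form of one direction: `‖H(C^{(μ)}, 0)‖_F² ≤ 16 Σ_x ‖C_μ(x)‖_F²`. -/
theorem hop_fwd_frob_le (μ : Fin 4) (C : Fin 4 → TorusSite 4 2 → Matrix (Fin N) (Fin N) ℂ) :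
    ∑ p, ∑ q, ‖H (fun ν x => if ν = μ then C ν x else 0) 0 p q‖ ^ 2 ≤
      16 * ∑ x : TorusSite 4 2, ∑ a, ∑ b, ‖C μ x a b‖ ^ 2 := by
  refine (BilinearBounds.hop_frob_le hH _ _).trans (le_of_eq ?_)
  simp only [Pi.zero_apply, Matrix.zero_apply, norm_zero, ne_eq, OfNat.ofNat_ne_zero,
    not_false_eq_true, zero_pow, Finset.sum_const_zero, mul_zero, add_zero]
  rw [← Finset.mul_sum, frob_dirOnly]
  ring

/-- Backward hopping form of one direction: `‖H(0, C^{(μ)})‖_F² ≤ 16 Σ_x ‖C_μ(x)‖_F²`. -/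
theorem hop_bwd_frob_le (μ : Fin 4) (C : Fin 4 → TorusSite 4 2 → Matrix (Fin N) (Fin N) ℂ) :
    ∑ p, ∑ q, ‖H 0 (fun ν y => if ν = μ then C ν y else 0) p q‖ ^ 2 ≤
      16 * ∑ x : TorusSite 4 2, ∑ a, ∑ b, ‖C μ x a b‖ ^ 2 := by
  refine (BilinearBounds.hop_frob_le hH _ _).trans (le_of_eq ?_)
  simp only [Pi.zero_apply, Matrix.zero_apply, norm_zero, ne_eq, OfNat.ofNat_ne_zero,
    not_false_eq_true, zero_pow, Finset.sum_const_zero, mul_zero, zero_add]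
  rw [← Finset.mul_sum, frob_dirOnly]
  ring

/-- **`Δ(Y ⋆ Y)` factors through kernels linear in `Y`.**  With `G⁺_μ(x) = u_μ Y(x,μ)`,
`G⁻_μ(x) = Y(x + μ̂, μ)ᴴ` (`= Y(x − μ̂, μ)ᴴ` on `(ℤ/2)⁴`), the forward inner field `Y^{(μ)}` and the
backward inner field `((u Y)ᴴ)^{(μ)}`:
`H(u(Y⋆Y), (u(Y⋆Y))ᴴ) = Σ_μ (D(G⁺_μ) H(Y^{(μ)}, 0) + D(G⁻_μ) H(0, ((uY)ᴴ)^{(μ)}))`. -/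
theorem dl_sq_factor
    {D : (TorusSite 4 2 → Matrix (Fin N) (Fin N) ℂ) →
      Matrix (TorusSite 4 2 × Fin N × Fin 4) (TorusSite 4 2 × Fin N × Fin 4) ℂ}
    (hD : ∀ G, D G = Matrix.of fun p s : TorusSite 4 2 × Fin N × Fin 4 =>
      if s.1 = p.1 then (if s.2.2 = p.2.2 then G p.1 p.2.1 s.2.1 else 0) else 0)
    (u : Fin 4 → Matrix.unitaryGroup (Fin N) ℂ) (Y : Edge 4 2 → Matrix (Fin N) (Fin N) ℂ) :
    H (fun ν x => (u ν : Matrix (Fin N) (Fin N) ℂ) * (Y (x, ν) * Y (x, ν)))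
        (fun ν y => ((u ν : Matrix (Fin N) (Fin N) ℂ) * (Y (y, ν) * Y (y, ν)))ᴴ) =
      ∑ μ : Fin 4,
        (D (fun x => (u μ : Matrix (Fin N) (Fin N) ℂ) * Y (x, μ)) *
            H (fun ν x => if ν = μ then Y (x, ν) else 0) 0 +
          D (fun x => (Y (Literature.MathematicalPhysics.QuantumFieldTheory.Site.shift x μ, μ))ᴴ) *
            H 0 (fun ν y => if ν = μ then ((u ν : Matrix (Fin N) (Fin N) ℂ) * Y (y, ν))ᴴ else 0)) := by
  -- shifting twice in the same direction is the identity on `(ℤ/2)⁴`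
  have hss : ∀ (a : TorusSite 4 2) (i : Fin 4),
      Literature.MathematicalPhysics.QuantumFieldTheory.Site.shift
        (Literature.MathematicalPhysics.QuantumFieldTheory.Site.shift a i) i = a := fun a i => by
    show a + Pi.single i 1 + Pi.single i 1 = a
    rw [add_assoc, ← Pi.single_add, show (1 : ZMod 2) + 1 = 0 from by decide, Pi.single_zero,
      add_zero]
  rw [hop_dir_sum hH]
  refine Finset.sum_congr rfl fun μ _ => ?_
  rw [bd_mul_hop hH hD, bd_mul_hop hH hD, ← Tadpole.hop_add hH]
  congr 1
  · funext ν x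
    simp only [Pi.add_apply, Pi.zero_apply, Matrix.mul_zero, add_zero]
    split_ifs with h
    · subst h
      rw [Matrix.mul_assoc]
    · rw [Matrix.mul_zero]
  · funext ν y
    simp only [Pi.add_apply, Pi.zero_apply, Matrix.mul_zero, zero_add]
    split_ifs with h
    · subst h
      rw [hss, ← Matrix.conjTranspose_mul, Matrix.mul_assoc]
    · rw [Matrix.mul_zero]
end Hop

open BilinearBounds (dl_frob_le sum_edge_eq) in
/-- **Sub-goal `stub_massLipschitzAllN` — mass dependence of the block Hessian, every colour number
`N`, dimension-free.**  On the `2⁴` block with arbitrary constant unitary direction links `u_μ ∈ U(N)`,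
masses `m`, `0`, coercivity constants `c_m, c_0 > 0` of `B_m = D₂[u](m)`, `B_z = D₂[u](0)` and the
hopping perturbation `Δ` (defining equations): for every link field `Y`,
`|Q_m(Y) − Q_0(Y)| ≤ |m| · (16/(c_m √c_0) + 16/(c_0 √c_m) + 40/(√c_m √c_0)) · ‖Y‖²`,
`Q(Y) = ½ Re tr (B⁻¹ Δ(Y) B⁻¹ Δ(Y)) − ½ Re tr (B⁻¹ Δ(Y ⋆ Y))` — the sibling's `stub_massLipschitz`
with `Fin 3 ↦ Fin N`, same constant.  Proof: `B_m = B_z + m · 1`, resolvent identity, the generic bubble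
estimate (`bubble_sub_le`, `‖Δ(Y)‖_F² ≤ 32 ‖Y‖²`), and for the tadpole the factorisation `dl_sq_factor`
with `|Re tr (B_m⁻¹ B_z⁻¹ D K)| ≤ ‖D‖_F ‖K‖_F/(√c_m √c_0)`, `‖D‖_F² = 4‖Y‖²_μ`, `‖K‖_F² ≤ 16‖Y‖²_μ`. -/
theorem stub_massLipschitzAllN : ∀ (N : ℕ) (m : ℝ) (u : Fin 4 → Matrix.unitaryGroup (Fin N) ℂ) (cm c0 : ℝ), 0 < cm → 0 < c0 → ∀ (Bm Bz : Matrix (TorusSite 4 2 × Fin N × Fin 4) (TorusSite 4 2 × Fin N × Fin 4) ℂ) (Dl : (Edge 4 2 → Matrix (Fin N) (Fin N) ℂ) → Matrix (TorusSite 4 2 × Fin N × Fin 4) (TorusSite 4 2 × Fin N × Fin 4) ℂ), Bm = wilsonDirac (unitaryFundamentalRep (Fin N) ℂ) (fun e : Edge 4 2 => u e.2) m 1 → Bz = wilsonDirac (unitaryFundamentalRep (Fin N) ℂ) (fun e : Edge 4 2 => u e.2) 0 1 → (∀ E, Dl E = Matrix.of fun (p q : TorusSite 4 2 × Fin N ×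 Fin 4) => -(1 / 2 : ℂ) * ∑ μ : Fin 4, ((if q.1 = Site.shift p.1 μ then ((1 : Matrix (Fin 4) (Fin 4) ℂ) - euclideanGamma μ) p.2.2 q.2.2 * (((u μ : Matrix.unitaryGroup (Fin N) ℂ) : Matrix (Fin N) (Fin N) ℂ) * E (p.1, μ)) p.2.1 q.2.1 else 0) + (if p.1 = Site.shift q.1 μ then ((1 : Matrix (Fin 4) (Fin 4) ℂ) + euclideanGamma μ) p.2.2 q.2.2 * (((u μ : Matrix.unitaryGroup (Fin N) ℂ) : Matrix (Fin N) (Fin N) ℂ) * E (q.1, μ))ᴴ p.2.1 q.2.1 else 0))) → (∀ v : TorusSite 4 2 × Fin N × Fin 4 → ℂ, cm * ∑ i, ‖v i‖ ^ 2 ≤ ∑ i, ‖(Bm.mulVec v) i‖ ^ 2) → (∀ v : TorusSite 4 2 × Fin N × Fin 4 → ℂ, c0 * ∑ i, ‖v i‖ ^ 2 ≤ ∑ i, ‖(Bz.mulVec v) i‖ ^ 2) → ∀ Y : Edge 4 2 → Matrix (Fin N) (Fin N) ℂ, |((Bm⁻¹ * Dl Y * (Bm⁻¹ * Dl Y)).trace.re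 / 2 - (Bm⁻¹ * Dl (fun e => Y e * Y e)).trace.re / 2) - ((Bz⁻¹ * Dl Y * (Bz⁻¹ * Dl Y)).trace.re / 2 - (Bz⁻¹ * Dl (fun e => Y e * Y e)).trace.re / 2)| ≤ |m| * (16 / (cm * Real.sqrt c0) + 16 / (c0 * Real.sqrt cm) + 40 / (Real.sqrt cm * Real.sqrt c0)) * (∑ e : Edge 4 2, ∑ a, ∑ b, ‖Y e a b‖ ^ 2) := by
  intro N m u cm c0 hcm hc0 Bm Bz Dl hBm hBz hDldef hcoem hcoe0 Y
  -- the mass enters only through the diagonal: `B_m = B_z + m · 1`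
  have hmass : Bm = Bz + (m : ℂ) • 1 := by
    rw [hBm, hBz]
    ext p q
    rw [Matrix.add_apply, Matrix.smul_apply, Matrix.one_apply]
    simp only [wilsonDirac, Matrix.of_apply]
    by_cases h : p = q
    · rw [if_pos h, if_pos h, if_pos h, smul_eq_mul]; push_cast; ring
    · rw [if_neg h, if_neg h, if_neg h, smul_zero, add_zero]
  -- the hopping form `H`: `Δ(E) = H(uE, (uE)ᴴ)`, and the block-diagonal colour multipliers `D`
  obtain ⟨H, hH⟩ : ∃ H : (Fin 4 → TorusSite 4 2 → Matrix (Fin N) (Fin N) ℂ) →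
      (Fin 4 → TorusSite 4 2 → Matrix (Fin N) (Fin N) ℂ) →
        Matrix (TorusSite 4 2 × Fin N × Fin 4) (TorusSite 4 2 × Fin N × Fin 4) ℂ,
      ∀ Cp Cm, H Cp Cm = Matrix.of fun p q : TorusSite 4 2 × Fin N × Fin 4 =>
        -(1 / 2 : ℂ) * ∑ μ : Fin 4,
          ((if q.1 = Literature.MathematicalPhysics.QuantumFieldTheory.Site.shift p.1 μ then
              ((1 : Matrix (Fin 4) (Fin 4) ℂ) - euclideanGamma μ) p.2.2 q.2.2 * Cp μ p.1 p.2.1 q.2.1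
            else 0) +
            (if p.1 = Literature.MathematicalPhysics.QuantumFieldTheory.Site.shift q.1 μ then
              ((1 : Matrix (Fin 4) (Fin 4) ℂ) + euclideanGamma μ) p.2.2 q.2.2 * Cm μ q.1 p.2.1 q.2.1
            else 0)) :=
    ⟨_, fun _ _ => rfl⟩
  obtain ⟨D, hD⟩ : ∃ D : (TorusSite 4 2 → Matrix (Fin N) (Fin N) ℂ) →
      Matrix (TorusSite 4 2 × Fin N × Fin 4) (TorusSite 4 2 × Fin N × Fin 4) ℂ,
      ∀ G, D G = Matrix.of fun p s : TorusSite 4 2 × Fin N × Fin 4 =>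
        if s.1 = p.1 then (if s.2.2 = p.2.2 then G p.1 p.2.1 s.2.1 else 0) else 0 :=
    ⟨_, fun _ => rfl⟩
  have hDl : ∀ E' : Edge 4 2 → Matrix (Fin N) (Fin N) ℂ,
      Dl E' = H (fun μ x => (u μ : Matrix (Fin N) (Fin N) ℂ) * E' (x, μ))
        (fun μ y => ((u μ : Matrix (Fin N) (Fin N) ℂ) * E' (y, μ))ᴴ) := fun E' => by
    rw [hDldef, hH]
  -- norms
  set nY : ℝ := ∑ e : Edge 4 2, ∑ a, ∑ b, ‖Y e a b‖ ^ 2 with hnY_def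
  set nd : Fin 4 → ℝ := fun μ => ∑ x : TorusSite 4 2, ∑ a, ∑ b, ‖Y (x, μ) a b‖ ^ 2 with hnd_def
  have hnd0 : ∀ μ, 0 ≤ nd μ := fun μ => by rw [hnd_def]; positivity
  have hnY0 : 0 ≤ nY := by rw [hnY_def]; positivity
  have hsum_nd : ∑ μ, nd μ = nY := by rw [hnY_def, sum_edge_eq Y]
  -- the Frobenius bound `‖Δ(Y)‖_F² ≤ 32 ‖Y‖²`
  have hF : ∑ p, ∑ q, ‖Dl Y p q‖ ^ 2 ≤ 32 * nY := by
    rw [hDl]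
    exact dl_frob_le hH u Y
  -- the resolvent identity
  have hR : Bm⁻¹ - Bz⁻¹ = -((m : ℂ) • (Bm⁻¹ * Bz⁻¹)) :=
    resolvent_sub Bm Bz m (det_ne_zero_of_coercive Bm hcm hcoem)
      (det_ne_zero_of_coercive Bz hc0 hcoe0) hmass
  -- (1) the bubble part
  have hK0 : 0 ≤ |m| * (1 / (cm * Real.sqrt c0) + 1 / (c0 * Real.sqrt cm)) := by positivity
  have hbub : |(Bm⁻¹ * Dl Y * (Bm⁻¹ * Dl Y)).trace.re - (Bz⁻¹ * Dl Y * (Bz⁻¹ * Dl Y)).trace.re| ≤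
      |m| * (1 / (cm * Real.sqrt c0) + 1 / (c0 * Real.sqrt cm)) * (32 * nY) :=
    (bubble_sub_le Bm Bz (Dl Y) m hcm hc0 hcoem hcoe0 hR).trans (mul_le_mul_of_nonneg_left hF hK0)
  -- (2) the tadpole part, dimension-free
  set Δ₂ : Matrix (TorusSite 4 2 × Fin N × Fin 4) (TorusSite 4 2 × Fin N × Fin 4) ℂ :=
    Dl (fun e => Y e * Y e) with hΔ₂_def
  have htr : (Bm⁻¹ * Δ₂).trace.re - (Bz⁻¹ * Δ₂).trace.re =
      -(m * (Bm⁻¹ * (Bz⁻¹ * Δ₂)).trace.re) := by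
    rw [← Complex.sub_re, ← Matrix.trace_sub, ← Matrix.sub_mul, hR, Matrix.neg_mul,
      Matrix.smul_mul, Matrix.mul_assoc, Matrix.trace_neg, Matrix.trace_smul, smul_eq_mul,
      Complex.neg_re, Complex.re_ofReal_mul]
  -- the factorisation of `Δ(Y ⋆ Y)`
  set P : Fin 4 → Matrix (TorusSite 4 2 × Fin N × Fin 4) (TorusSite 4 2 × Fin N × Fin 4) ℂ :=
    fun μ => D (fun x => (u μ : Matrix (Fin N) (Fin N) ℂ) * Y (x, μ)) *
      H (fun ν x => if ν = μ then Y (x, ν) else 0) 0 with hP_def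
  set Q : Fin 4 → Matrix (TorusSite 4 2 × Fin N × Fin 4) (TorusSite 4 2 × Fin N × Fin 4) ℂ :=
    fun μ => D (fun x => (Y (Literature.MathematicalPhysics.QuantumFieldTheory.Site.shift x μ, μ))ᴴ) *
      H 0 (fun ν y => if ν = μ then ((u ν : Matrix (Fin N) (Fin N) ℂ) * Y (y, ν))ᴴ else 0)
    with hQ_def
  have hfac : Δ₂ = ∑ μ, (P μ + Q μ) := by
    rw [hΔ₂_def, hDl]
    exact dl_sq_factor hH hD u Y
  have htrace : (Bm⁻¹ * (Bz⁻¹ * Δ₂)).trace.re =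
      ∑ μ, ((Bm⁻¹ * (Bz⁻¹ * P μ)).trace.re + (Bm⁻¹ * (Bz⁻¹ * Q μ)).trace.re) := by
    rw [hfac, Matrix.mul_sum, Matrix.mul_sum, Matrix.trace_sum, Complex.re_sum]
    refine Finset.sum_congr rfl fun μ _ => ?_
    rw [Matrix.mul_add, Matrix.mul_add, Matrix.trace_add, Complex.add_re]
  -- termwise `|Re tr (B_m⁻¹ B_z⁻¹ D(G) K)| ≤ 8‖Y‖²_μ/(√c_m √c_0)` if `Σ_x‖G(x)‖² = ‖Y‖²_μ`, `‖K‖² ≤ 16‖Y‖²_μ`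
  have hden : 0 < Real.sqrt cm * Real.sqrt c0 := by positivity
  have hshift : ∀ (μ : Fin 4) (g : TorusSite 4 2 → ℝ),
      ∑ x, g (Literature.MathematicalPhysics.QuantumFieldTheory.Site.shift x μ) = ∑ x, g x :=
    fun μ g => Fintype.sum_equiv (Equiv.addRight (Pi.single μ (1 : ZMod 2))) _ _ fun _ => rfl
  have hterm : ∀ (μ : Fin 4) (G : TorusSite 4 2 → Matrix (Fin N) (Fin N) ℂ)
      (K : Matrix (TorusSite 4 2 × Fin N × Fin 4) (TorusSite 4 2 × Fin N × Fin 4) ℂ),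
      ∑ x, ∑ a, ∑ b, ‖G x a b‖ ^ 2 = nd μ → ∑ p, ∑ q, ‖K p q‖ ^ 2 ≤ 16 * nd μ →
        |(Bm⁻¹ * (Bz⁻¹ * (D G * K))).trace.re| ≤ 8 * nd μ / (Real.sqrt cm * Real.sqrt c0) := by
    intro μ G K hG hK
    have h8 : Real.sqrt (4 * nd μ) * Real.sqrt (16 * nd μ) = 8 * nd μ := by
      rw [← Real.sqrt_mul (by positivity : (0 : ℝ) ≤ 4 * nd μ),
        show 4 * nd μ * (16 * nd μ) = (8 * nd μ) ^ 2 by ring,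
        Real.sqrt_sq (by positivity : (0 : ℝ) ≤ 8 * nd μ)]
    refine (abs_re_trace_inv_inv_mul_le Bm Bz _ _ hcm hc0 hcoem hcoe0).trans ?_
    rw [bd_frob hD, hG, ← h8]
    exact div_le_div_of_nonneg_right
      (mul_le_mul_of_nonneg_left (Real.sqrt_le_sqrt hK) (Real.sqrt_nonneg _)) hden.le
  have hPμ : ∀ μ, |(Bm⁻¹ * (Bz⁻¹ * P μ)).trace.re| ≤ 8 * nd μ / (Real.sqrt cm * Real.sqrt c0) :=
    fun μ => hterm μ (fun x => (u μ : Matrix (Fin N) (Fin N) ℂ) * Y (x, μ))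
      (H (fun ν x => if ν = μ then Y (x, ν) else 0) 0)
      (by simp only [TangentDelta.sum_norm_sq_unitary_mul]; rfl)
      (hop_fwd_frob_le hH μ (fun ν x => Y (x, ν)))
  have hQμ : ∀ μ, |(Bm⁻¹ * (Bz⁻¹ * Q μ)).trace.re| ≤ 8 * nd μ / (Real.sqrt cm * Real.sqrt c0) :=
    fun μ => hterm μ
      (fun x => (Y (Literature.MathematicalPhysics.QuantumFieldTheory.Site.shift x μ, μ))ᴴ)
      (H 0 (fun ν y => if ν = μ then ((u ν : Matrix (Fin N) (Fin N) ℂ) * Y (y, ν))ᴴ else 0))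
      (by simp only [TangentDelta.sum_norm_sq_conjTranspose]
          exact hshift μ (fun x => ∑ a, ∑ b, ‖Y (x, μ) a b‖ ^ 2))
      ((hop_bwd_frob_le hH μ _).trans (le_of_eq (by
        simp only [TangentDelta.sum_norm_sq_conjTranspose, TangentDelta.sum_norm_sq_unitary_mul]
        rfl)))
  have htad0 : |(Bm⁻¹ * (Bz⁻¹ * Δ₂)).trace.re| ≤ 16 * nY / (Real.sqrt cm * Real.sqrt c0) := by
    rw [htrace]
    calc |∑ μ, ((Bm⁻¹ * (Bz⁻¹ * P μ)).trace.re + (Bm⁻¹ * (Bz⁻¹ * Q μ)).trace.re)|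
        ≤ ∑ μ, |(Bm⁻¹ * (Bz⁻¹ * P μ)).trace.re + (Bm⁻¹ * (Bz⁻¹ * Q μ)).trace.re| :=
          Finset.abs_sum_le_sum_abs _ _
      _ ≤ ∑ μ, (8 * nd μ / (Real.sqrt cm * Real.sqrt c0) + 8 * nd μ / (Real.sqrt cm * Real.sqrt c0)) :=
          Finset.sum_le_sum fun μ _ => (abs_add_le _ _).trans (add_le_add (hPμ μ) (hQμ μ))
      _ = 16 * nY / (Real.sqrt cm * Real.sqrt c0) := by
          rw [← hsum_nd, Finset.mul_sum, Finset.sum_div]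
          exact Finset.sum_congr rfl fun μ _ => by ring
  have htad : |(Bm⁻¹ * Δ₂).trace.re - (Bz⁻¹ * Δ₂).trace.re| ≤
      |m| * (16 / (Real.sqrt cm * Real.sqrt c0)) * nY := by
    rw [htr, abs_neg, abs_mul]
    calc |m| * |(Bm⁻¹ * (Bz⁻¹ * Δ₂)).trace.re|
        ≤ |m| * (16 * nY / (Real.sqrt cm * Real.sqrt c0)) :=
          mul_le_mul_of_nonneg_left htad0 (abs_nonneg m)
      _ = |m| * (16 / (Real.sqrt cm * Real.sqrt c0)) * nY := by ring
  -- (3) assembly: halve, and `8 ≤ 40`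
  have hslack : 0 ≤ |m| * (32 / (Real.sqrt cm * Real.sqrt c0)) * nY := by positivity
  have heq : |m| * (1 / (cm * Real.sqrt c0) + 1 / (c0 * Real.sqrt cm)) * (32 * nY) / 2 +
      |m| * (16 / (Real.sqrt cm * Real.sqrt c0)) * nY / 2 +
        |m| * (32 / (Real.sqrt cm * Real.sqrt c0)) * nY =
      |m| * (16 / (cm * Real.sqrt c0) + 16 / (c0 * Real.sqrt cm) +
        40 / (Real.sqrt cm * Real.sqrt c0)) * nY := by ring
  have h := abs_half_sub_half_le hbub htad
  rw [hΔ₂_def] at h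
  linarith

end Summit.QuantumFields.QCD.Cruxes.FlatCellOptimal.MassLipschitz

end
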